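import Summits.QuantumFields.YangMills.Theorems.BalabanUVNodesN11KernelTransportInFibreChart
import Summits.QuantumFields.YangMills.Theorems.BalabanUVNodesN11KernelTransportSkewProduct

/-!
# DAG node N11 — THE SEPARATION FACE OF (B4) WITH THE INNER FIBRE CHARTED (consumer endpoint): along a SKEW product averaging, def-T's transport of `ρ` IS the TRUE outside
# transport of the INSIDE CHART INTEGRAL `u₁ ↦ ∫ J((u₁,v₂),x)·ρ(u₁, Ψ((u₁,v₂),x)) κ_{(u₁,v₂)}(dx)` — plus the socket's sanity inhabitant (a product projection) and two plumbing lemmas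

HEADER — WORK-UNIT METADATA.  Cell `pub-ymgap`, YM-PLAN Track A (HUMAN RULING D-0062), seat `pub-ymgap-dag-n11-d` (g14; R134 fan-out base seat N11 [B14], strategy s2),
route `BalabanUVNodes` rev 25, item K1⁷ `StabilityBAtRecordR13SepCoPH` = stmt-QuantumFields-20542 (helper lane, `--kind proof --supports 20542 --as helper`, count-neutral).
[I] = [Balaban1987RG1], [III] = [Balaban1988Convergent], [15] = [Balaban1985Variational].  Over this seat's `…N11KernelTransportInFibreChart` (p610288: the fibre-chart socket
`hpush` ∕ `hfib` ⇒ `kernelTransport … =ᵐ` the chart integral, fibre reference an s-finite KERNEL) and dag-n11-w2 g3's `…N11KernelTransportSkewProduct` (p611138: transitivity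
`kernelTransport_comp_ae_eq`, the out-factor `kernelTransport_prodMap_id_ae_eq`, ★★★ `kernelTransport_skewProduct_ae_eq` with the inner reading `hin` DISPLAYED), over node00-def-T's
`T4AveragingDisintegration`.  (INTENT-3 `…ChainRule` re-scoped after dag-n11-w2's earlier CLAIM on the generic chain rule — pub-ymgap INBOX ACK-(A) 2026-08-28 ≈07:00Z.)

WHY THIS FILE.  dag-n11-e g20's refined (O3′)-matching shape of (B4) (INBOX I.30188): fine variables `(u₁, u₂) ∈ β₁ × β₂` (outside ∕ inside `Ω_{k+1}`) with the product reference
`ν₁ ⊗ ν₂`, coarse `(v₁, v₂)` with `μ₁ ⊗ μ₂`, a SKEW averaging `avg (u₁,u₂) = (a₁ u₁, a₂ (u₁,u₂))` — the outside coarse field reads the outside fine field only ((0.4)'s two-block window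
on a block-saturated `Ω^c_{k+1}`, dag-n11-e's `AveragingTwoBlockWindow`), the inside one may read both —; the outside variables must come out transported by the TRUE, un-charted
kernel (11a's `vOp`), the inside ones charted.  dag-n11-w2's ★★★ gives exactly that modulo a displayed inner reading `hin : kernelTransport (ν₁ ⊗ ν₂) (ν₁ ⊗ μ₂) (u ↦ (u.1, a₂ u)) ρ =ᵐ F`;
this seat's socket DISCHARGES `hin` for the chart integral `F` of ANY fibre chart of the inner, first-coordinate-preserving map — with a `(u₁, v₂)`-DEPENDENT fibre reference
`κ (u₁, v₂)` (what the `ker Q(U₀)`-parametrisation of [15] (47) produces).  §2 composes the two BY NAME into the consumer endpoint; §1 inhabits the socket at the simplest averaging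
(a product projection: `Ψ = id`, `J = 1`), so that the displayed hypotheses `hpush` ∕ `hfib` are seen to be satisfiable and the endpoint is not vacuous-by-shape; §0 keeps two
plumbing lemmas of the disintegration (the `ℝ≥0∞` identity; integrability of the parametric transport) that neither landed file declares.

WHAT THIS FILE PROVES (0 `def`, 0 `sorry`, standard axioms; generic measurable spaces).
§0 `lintegral_margDensity_mul_lintegral_condLaw` (`∫⁻ margDensity·(∫⁻ g ∂condLaw) ∂μ = ∫⁻ g ∂ν`) · `integrable_kernelTransport_param` (the out-factor transport of a `(ν₁ ⊗ μ₂)`-integrable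
   `G`, fibrewise in the parameter, is `(μ₁ ⊗ μ₂)`-integrable).
§1 `map_withDensity_one_id_eq_restrict_univ` · ★ `kernelTransport_fst_prod_ae_eq_integral` (THE SOCKET INHABITED: along `Prod.fst : α × X → α` with `ν = μ ⊗ λ`, the transport of `ρ`
   is `V ↦ ∫ ρ(V,x) dλ` a.e. — p610288's ★★★ at the identity chart).
§2 ★★★ `kernelTransport_skew_ae_eq_of_innerChart` (THE ENDPOINT, `⊗ₘ κ` generality).

HONEST FRAMING.  Helper lane of K1⁷; count-neutral; composition of landed measure theory; no chart of Bałaban's constructed, no Jacobian computed, the skew SHAPE of `avg` and the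
inner chart's `hpush`∕`hfib` are HYPOTHESES; nothing of Bałaban ([I] §2, [III] §3, [15] Sect. C) asserted; (B4) ∕ (S-α) NOT closed; N11 NOT discharged; K1⁷ NOT closed; counts unmoved
(typed 28∕28 · discharged 5∕27).  One finite `𝕋⁴_{L^K}` programme at fixed `ε = L^{−K}`; R4 closes only the conditional finite-𝕋⁴ rung `BalabanLadder.UV` — NOT ℝ⁴, NOT OS, NOT a mass
gap, NOT Clay.  No `sorry`, `axiom`, `def`, `instance`, `notation`.
Sources (SHAPE ∕ bookkeeping only): [I] (0.4) p.253, p.267; [III] (2.21) p.258, (3.1) p.264, pp.267–270; [15] (47)–(49) pp.287–288.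
-/

noncomputable section

open MeasureTheory ProbabilityTheory
open scoped ENNReal NNReal

namespace Summit.QuantumFields.YangMills.Theorems.BalabanUVNodesN11KernelTransportSkewInnerChart

open Literature.MathematicalPhysics.QuantumFieldTheory.Balaban1983to89
open Literature.MathematicalPhysics.QuantumFieldTheory.Balaban1983to89.T4AveragingDisintegration
open BalabanUVNodesN11TkOpMeasurable (measurable_kernelTransport_param)
open BalabanUVNodesN11KernelTransportInFibreChart (integrable_integral_chart kernelTransport_ae_eq_integral_chart_of_support)
open BalabanUVNodesN11KernelTransportSkewProduct (kernelTransport_skewProduct_ae_eq)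

/-! ## §0  Plumbing: the disintegration identity for `ℝ≥0∞` integrands; integrability of the parametric out-factor transport -/

section Basic

variable {α β : Type*} [MeasurableSpace α] [MeasurableSpace β] [StandardBorelSpace β] [Nonempty β]

/-- **THE DISINTEGRATION IDENTITY FOR `ℝ≥0∞` INTEGRANDS**: `∫⁻ dμ(V) margDensity(V)·∫⁻ g condLaw(V) = ∫⁻ g dν` for every measurable `g ≥ 0` (def-T's `disintegration`
`μ.withDensity margDensity ⊗ₘ condLaw = jointLaw` read through Tonelli for kernels). [cite: Balaban1987RG1, (0.4) p.253 (bookkeeping)] -/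
theorem lintegral_margDensity_mul_lintegral_condLaw (ν : Measure β) [IsFiniteMeasure ν] (μ : Measure α) [SigmaFinite μ] {avg : β → α}
    (havg : Measurable avg) (hac : ν.map avg ≪ μ) {g : β → ℝ≥0∞} (hg : Measurable g) :
    ∫⁻ V, (margDensity ν μ avg V : ℝ≥0∞) * ∫⁻ U, g U ∂(condLaw ν avg V) ∂μ = ∫⁻ U, g U ∂ν := by
  have hm : Measurable fun V => (margDensity ν μ avg V : ℝ≥0∞) := measurable_margDensity.coe_nnreal_ennreal
  have hg2 : Measurable fun z : α × β => g z.2 := hg.comp measurable_snd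
  have h1 : ∫⁻ z, g z.2 ∂(jointLaw ν avg) = ∫⁻ U, g U ∂ν := by
    unfold jointLaw
    rw [lintegral_map hg2 (measurable_graphMap havg)]
  rw [← h1, ← disintegration ν μ havg hac, Measure.lintegral_compProd hg2,
    lintegral_withDensity_eq_lintegral_mul _ hm
      (show Measurable fun V => ∫⁻ U, g U ∂(condLaw ν avg V) from Measurable.lintegral_kernel_prod_right' (f := fun z : α × β => g z.2) hg2)]
  rfl

end Basic

section Param

variable {α₁ α₂ β₁ : Type*} [MeasurableSpace α₁] [MeasurableSpace α₂] [MeasurableSpace β₁] [StandardBorelSpace β₁] [Nonempty β₁]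
variable (ν₁ : Measure β₁) [IsFiniteMeasure ν₁] (μ₁ : Measure α₁) [SigmaFinite μ₁] (μ₂ : Measure α₂) [IsFiniteMeasure μ₂]
variable {a₁ : β₁ → α₁}

/-- **THE OUT-FACTOR TRANSPORT OF A `(ν₁ ⊗ μ₂)`-INTEGRABLE `G`, FIBREWISE IN THE PARAMETER `v₂`, IS `(μ₁ ⊗ μ₂)`-INTEGRABLE**: jointly measurable by this seat's
`measurable_kernelTransport_param` (p-TkOpMeasurable); its norm is dominated by the transport of `|G|`, whose total mass is `∫∫ |G| dν₁ dμ₂` by §0 and Tonelli.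
[cite: Balaban1987RG1, (0.4) p.253 (bookkeeping)] -/
theorem integrable_kernelTransport_param (ha₁ : Measurable a₁) (hac₁ : ν₁.map a₁ ≪ μ₁)
    {G : β₁ × α₂ → ℝ} (hGm : Measurable G) (hG : Integrable G (ν₁.prod μ₂)) :
    Integrable (fun v : α₁ × α₂ => kernelTransport ν₁ μ₁ a₁ (fun u₁ => G (u₁, v.2)) v.1) (μ₁.prod μ₂) := by
  have hmeas : Measurable fun v : α₁ × α₂ => kernelTransport ν₁ μ₁ a₁ (fun u₁ => G (u₁, v.2)) v.1 := by
    have h := measurable_kernelTransport_param (γ := α₂) ν₁ μ₁ a₁ (f := fun z : α₂ × β₁ => G (z.2, z.1)) (by fun_prop)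
    exact h.comp (measurable_snd.prodMk measurable_fst)
  refine ⟨hmeas.aestronglyMeasurable, ?_⟩
  -- pointwise: ‖d(v₁)·∫ G(·,v₂) dκ_{v₁}‖ₑ ≤ d(v₁)·∫⁻ ‖G(·,v₂)‖ₑ dκ_{v₁}
  have hpt : ∀ v : α₁ × α₂, ‖kernelTransport ν₁ μ₁ a₁ (fun u₁ => G (u₁, v.2)) v.1‖ₑ ≤
      (margDensity ν₁ μ₁ a₁ v.1 : ℝ≥0∞) * ∫⁻ u₁, ‖G (u₁, v.2)‖ₑ ∂(condLaw ν₁ a₁ v.1) := by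
    intro v
    simp only [kernelTransport]
    rw [enorm_mul]
    gcongr
    · simp
    · exact enorm_integral_le_lintegral_enorm _
  -- total mass of the bound: Tonelli (μ₂ outer), the disintegration identity in `v₁`, Tonelli back
  have hbound : ∫⁻ v, (margDensity ν₁ μ₁ a₁ v.1 : ℝ≥0∞) * ∫⁻ u₁, ‖G (u₁, v.2)‖ₑ ∂(condLaw ν₁ a₁ v.1) ∂(μ₁.prod μ₂) =
      ∫⁻ z, ‖G z‖ₑ ∂(ν₁.prod μ₂) := by
    have hF : Measurable fun v : α₁ × α₂ => (margDensity ν₁ μ₁ a₁ v.1 : ℝ≥0∞) * ∫⁻ u₁, ‖G (u₁, v.2)‖ₑ ∂(condLaw ν₁ a₁ v.1) := by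
      refine (measurable_margDensity.comp measurable_fst).coe_nnreal_ennreal.mul ?_
      exact Measurable.lintegral_kernel_prod_right' (κ := (condLaw ν₁ a₁).comap Prod.fst measurable_fst)
        (f := fun p : (α₁ × α₂) × β₁ => ‖G (p.2, p.1.2)‖ₑ) (by fun_prop)
    rw [lintegral_prod_symm _ hF.aemeasurable, lintegral_prod_symm _ (by fun_prop : Measurable fun z : β₁ × α₂ => ‖G z‖ₑ).aemeasurable]
    refine lintegral_congr fun v₂ => ?_
    exact lintegral_margDensity_mul_lintegral_condLaw ν₁ μ₁ ha₁ hac₁ (g := fun u₁ => ‖G (u₁, v₂)‖ₑ) (by fun_prop)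
  calc ∫⁻ v, ‖kernelTransport ν₁ μ₁ a₁ (fun u₁ => G (u₁, v.2)) v.1‖ₑ ∂(μ₁.prod μ₂)
      ≤ ∫⁻ v, (margDensity ν₁ μ₁ a₁ v.1 : ℝ≥0∞) * ∫⁻ u₁, ‖G (u₁, v.2)‖ₑ ∂(condLaw ν₁ a₁ v.1) ∂(μ₁.prod μ₂) := lintegral_mono hpt
    _ = ∫⁻ z, ‖G z‖ₑ ∂(ν₁.prod μ₂) := hbound
    _ < ⊤ := hG.2

end Param

/-! ## §1  The socket inhabited: a product projection (identity chart, unit Jacobian) -/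

section Inhabitant

variable {α X : Type*} [MeasurableSpace α] [MeasurableSpace X]

/-- The identity chart of a product: with the constant fibre reference `λ`, the identity map and unit Jacobian, p610288's `hpush` holds for `ν = μ ⊗ λ`, `avg = Prod.fst` on `S = univ`
(`Measure.compProd_const`, `withDensity_one`). [cite: Balaban1987RG1, (0.4) p.253 (bookkeeping: the trivial instance of the chart socket)] -/
theorem map_withDensity_one_id_eq_restrict_univ (μ : Measure α) [SFinite μ] (lam : Measure X) [SFinite lam] :
    ((μ ⊗ₘ Kernel.const α lam).withDensity (fun z => ((fun _ : α × X => (1 : ℝ≥0)) z : ℝ≥0∞))).map (fun z : α × X => z) = (μ.prod lam).restrict Set.univ := by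
  rw [Measure.restrict_univ, Measure.compProd_const]
  have h1 : (fun z : α × X => (((fun _ : α × X => (1 : ℝ≥0)) z : ℝ≥0) : ℝ≥0∞)) = 1 := by
    funext z; simp
  rw [h1, withDensity_one]
  exact Measure.map_id

variable [StandardBorelSpace α] [Nonempty α] [StandardBorelSpace X] [Nonempty X]

/-- **★ THE SOCKET INHABITED — THE TRANSPORT ALONG A PRODUCT PROJECTION INTEGRATES OUT THE FIBRE**: for finite `μ`, `λ` and a `(μ ⊗ λ)`-integrable measurable `ρ`,
`kernelTransport (μ.prod λ) μ Prod.fst ρ =ᵐ[μ] V ↦ ∫ ρ (V, x) dλ` — p610288's ★★★ `kernelTransport_ae_eq_integral_chart_of_support` at the identity chart with unit Jacobian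
(so the displayed hypotheses `hpush` ∕ `hfib` of the socket are satisfiable, and by genuine data). [cite: Balaban1987RG1, (0.4) p.253 (bookkeeping)] -/
theorem kernelTransport_fst_prod_ae_eq_integral (μ : Measure α) [IsFiniteMeasure μ] (lam : Measure X) [IsFiniteMeasure lam]
    {ρ : α × X → ℝ} (hρm : Measurable ρ) (hρ : Integrable ρ (μ.prod lam)) :
    kernelTransport (μ.prod lam) μ Prod.fst ρ =ᵐ[μ] fun V => ∫ x, ρ (V, x) ∂lam := by
  have hac : (μ.prod lam).map Prod.fst ≪ μ := by
    rw [Measure.map_fst_prod]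
    exact Measure.smul_absolutelyContinuous
  have hfib : ∀ᵐ z ∂((μ ⊗ₘ Kernel.const α lam).withDensity (fun z => ((fun _ : α × X => (1 : ℝ≥0)) z : ℝ≥0∞))),
      Prod.fst ((fun z : α × X => z) z) = z.1 := Filter.Eventually.of_forall fun _ => rfl
  have h := kernelTransport_ae_eq_integral_chart_of_support (ν := μ.prod lam) (μ := μ) (κ := Kernel.const α lam) (S := Set.univ)
    measurable_fst hac measurable_id measurable_const (map_withDensity_one_id_eq_restrict_univ μ lam) hfib hρm hρ (fun U hU => absurd (Set.mem_univ U) hU)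
  filter_upwards [h] with V hV
  rw [hV]
  simp [Kernel.const_apply]

end Inhabitant

/-! ## §2  ★★★ THE ENDPOINT: the skew separation face with the inner fibre charted -/

section Skew

variable {α₁ α₂ β₁ β₂ X : Type*} [MeasurableSpace α₁] [MeasurableSpace α₂] [MeasurableSpace β₁] [MeasurableSpace β₂] [MeasurableSpace X]
  [StandardBorelSpace β₁] [Nonempty β₁] [StandardBorelSpace β₂] [Nonempty β₂] [StandardBorelSpace α₂] [Nonempty α₂]
variable (ν₁ : Measure β₁) [IsFiniteMeasure ν₁] (ν₂ : Measure β₂) [IsFiniteMeasure ν₂] (μ₁ : Measure α₁) [SigmaFinite μ₁] (μ₂ : Measure α₂) [IsFiniteMeasure μ₂]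
variable {a₁ : β₁ → α₁} {a₂ : β₁ × β₂ → α₂}
variable {κ : Kernel (β₁ × α₂) X} [IsSFiniteKernel κ] {Ψ : (β₁ × α₂) × X → β₂} {J : (β₁ × α₂) × X → ℝ≥0} {S : Set (β₁ × β₂)}

/-- **★★★ THE SEPARATION FACE OF (B4) WITH THE INNER FIBRE CHARTED — «OUTSIDE VARIABLES BY THE TRUE, UN-CHARTED TRANSPORT; INSIDE VARIABLES OF THE OPERAND READ AT THE CHART
POINT»** ([III] (2.21)'s shape `∫dV|_{out} δ(V̄V′⁻¹) … ∫dA|_{in} …`).  Data: fine variables `(u₁, u₂) ∈ β₁ × β₂` with the product reference `ν₁ ⊗ ν₂`, coarse `(v₁, v₂) ∈ α₁ × α₂` with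
`μ₁ ⊗ μ₂`; SKEW averaging `avg (u₁,u₂) = (a₁ u₁, a₂ (u₁,u₂))` (outside coarse reads outside fine ONLY — the shape is the hypothesis; at the record it is (0.4)'s window on a
block-saturated `Ω^c_{k+1}`); `ν₁.map a₁ ≪ μ₁`; the inner step `u ↦ (u.1, a₂ u)` absolutely continuous onto `ν₁ ⊗ μ₂`; and a FIBRE CHART of that inner step against `(ν₁ ⊗ ν₂, ν₁ ⊗ μ₂)`
on `S`, parametrised by `w = (u₁, v₂)`: fibre references `κ w` (a KERNEL — `w`-dependent), inside configuration `Ψ (w, x)`, Jacobian `J`, with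
`hpush : (((ν₁ ⊗ μ₂) ⊗ₘ κ).withDensity J).map ((w,x) ↦ (w.1, Ψ(w,x))) = (ν₁ ⊗ ν₂).restrict S` and `hfib : a₂ (w.1, Ψ(w,x)) = w.2` a.e.  THEN for every `(ν₁ ⊗ ν₂)`-integrable measurable
`ρ` vanishing off `S`:  `kernelTransport (ν₁ ⊗ ν₂) (μ₁ ⊗ μ₂) avg ρ =ᵐ (v₁,v₂) ↦ kernelTransport ν₁ μ₁ a₁ (u₁ ↦ ∫ J((u₁,v₂),x)·ρ(u₁, Ψ((u₁,v₂),x)) κ_{(u₁,v₂)}(dx)) v₁`.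
= dag-n11-w2's ★★★ `kernelTransport_skewProduct_ae_eq` with its displayed inner reading `hin` SUPPLIED by this seat's ★★★ `kernelTransport_ae_eq_integral_chart_of_support` at the
inner map. [cite: Balaban1988Convergent, (2.21) p.258, (3.1) p.264, pp.267–270; Balaban1987RG1, (0.4) p.253, p.267; Balaban1985Variational, (47)–(49) pp.287–288] -/
theorem kernelTransport_skew_ae_eq_of_innerChart (ha₁ : Measurable a₁) (hac₁ : ν₁.map a₁ ≪ μ₁) (ha₂ : Measurable a₂)
    (hac₂ : (ν₁.prod ν₂).map (fun u : β₁ × β₂ => (u.1, a₂ u)) ≪ ν₁.prod μ₂)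
    (hΨ : Measurable Ψ) (hJ : Measurable J)
    (hpush : (((ν₁.prod μ₂) ⊗ₘ κ).withDensity (fun z => (J z : ℝ≥0∞))).map (fun z => ((z.1.1, Ψ z) : β₁ × β₂)) = (ν₁.prod ν₂).restrict S)
    (hfib : ∀ᵐ z ∂(((ν₁.prod μ₂) ⊗ₘ κ).withDensity (fun z => (J z : ℝ≥0∞))), a₂ (z.1.1, Ψ z) = z.1.2)
    {ρ : β₁ × β₂ → ℝ} (hρm : Measurable ρ) (hρ : Integrable ρ (ν₁.prod ν₂)) (hρS : ∀ u, u ∉ S → ρ u = 0) :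
    kernelTransport (ν₁.prod ν₂) (μ₁.prod μ₂) (fun u : β₁ × β₂ => (a₁ u.1, a₂ u)) ρ =ᵐ[μ₁.prod μ₂]
      fun v => kernelTransport ν₁ μ₁ a₁ (fun u₁ => ∫ x, (J ((u₁, v.2), x) : ℝ) * ρ (u₁, Ψ ((u₁, v.2), x)) ∂(κ (u₁, v.2))) v.1 := by
  -- the inner, first-coordinate-preserving map and its chart
  have hin_meas : Measurable fun u : β₁ × β₂ => (u.1, a₂ u) := measurable_fst.prodMk ha₂
  have hΨ' : Measurable fun z : (β₁ × α₂) × X => ((z.1.1, Ψ z) : β₁ × β₂) := measurable_fst.fst.prodMk hΨ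
  have hfib' : ∀ᵐ z ∂(((ν₁.prod μ₂) ⊗ₘ κ).withDensity (fun z => (J z : ℝ≥0∞))),
      (fun u : β₁ × β₂ => (u.1, a₂ u)) ((fun z : (β₁ × α₂) × X => ((z.1.1, Ψ z) : β₁ × β₂)) z) = z.1 := by
    filter_upwards [hfib] with z hz
    exact Prod.ext rfl hz
  -- the inner reading IS the chart integral (this seat's socket)
  have hin := kernelTransport_ae_eq_integral_chart_of_support (ν := ν₁.prod ν₂) (μ := ν₁.prod μ₂) (κ := κ)
    hin_meas hac₂ hΨ' hJ hpush hfib' hρm hρ hρS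
  -- the chart integral is jointly measurable in `(u₁, v₂)`
  have hFm : Measurable fun w : β₁ × α₂ => ∫ x, (J (w, x) : ℝ) * ρ ((fun z : (β₁ × α₂) × X => ((z.1.1, Ψ z) : β₁ × β₂)) (w, x)) ∂(κ w) :=
    (StronglyMeasurable.integral_kernel_prod_right' (κ := κ) (f := fun z : (β₁ × α₂) × X => (J z : ℝ) * ρ ((z.1.1, Ψ z) : β₁ × β₂))
      (by fun_prop : Measurable fun z : (β₁ × α₂) × X => (J z : ℝ) * ρ ((z.1.1, Ψ z) : β₁ × β₂)).stronglyMeasurable).measurable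
  -- dag-n11-w2's skew-product chain rule with `hin` supplied
  exact kernelTransport_skewProduct_ae_eq ν₁ ν₂ μ₁ μ₂ ha₁ ha₂ hac₁ hac₂ hρ hFm hin

end Skew

end Summit.QuantumFields.YangMills.Theorems.BalabanUVNodesN11KernelTransportSkewInnerChart

end
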